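import Literature.AlgebraicTopology.SingularHomology.SphereComplementProofs
import Literature.AlgebraicTopology.SingularHomology.SphereHomology
import Literature.AlgebraicTopology.SingularHomology.MayerVietorisExactness
import HarnessLib

/-!
# Complements of embedded spheres in `𝕊ⁿ`: the non-vanishing degree (Hatcher, Prop. 2B.1(b))

A. Hatcher, *Algebraic Topology*, CUP 2002, Prop. 2B.1(b): *for an embedding `h : Sᵏ → Sⁿ` with
`k < n`, `H̃ᵢ(Sⁿ ∖ h(Sᵏ))` is `ℤ` for `i = n - k - 1` and `0` otherwise.* The vanishing part is
proved in `SphereComplement.lean` / `SphereComplementProofs.lean`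
(`SphereComplement.isZero_compl_range_of_isEmbedding_holds`). This file proves the remaining
**isomorphism part**, for Mathlib's singular homology with arbitrary coefficients, by the same
induction (Hatcher 2002, p. 170: "the Mayer–Vietoris sequence gives isomorphisms
`H̃ᵢ(Sⁿ − h(Sᵏ)) ≈ H̃ᵢ₊₁(Sⁿ − h(Sᵏ⁻¹))`"), in the positive-degree form that needs no reduced
homology:

* `mayerVietoris.isIso_δ_of_isZero` — in the Mayer–Vietoris sequence of a cover
  `interior U ∪ interior V = X`, the connecting map `δ : Hₙ₊₁(X) ⟶ Hₙ(U ∩ V)` is an isomorphism as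
  soon as `Hₙ₊₁(U) = Hₙ₊₁(V) = Hₙ(U) = Hₙ(V) = 0` (exactness at `Hₙ₊₁(X)` and at `Hₙ(U ∩ V)`,
  `mayerVietoris.exact₂_holds` / `exact₃_holds`, Hatcher §2.2 p. 149);
* `SphereComplement.nonempty_iso_union_inter_of_isZero` — the same for two open subsets
  `U₁, U₂` of an ambient space: `Hᵢ₊₁(U₁ ∪ U₂; M) ≅ Hᵢ(U₁ ∩ U₂; M)`;
* `SphereComplement.nonempty_iso_compl_range_sphere` — for a continuous injection
  `f : 𝕊ᵏ → 𝕊ᵐ⁺¹`, `k ≤ m`, and `i ≥ 1`: `Hᵢ(𝕊ᵐ⁺¹ ∖ f(𝕊ᵏ); M) ≅ Hᵢ₊ₖ(𝕊ᵐ; M)` (induction on `k`: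
  for `k = 0` the complement of two points of `𝕊ᵐ⁺¹` is `ℝᵐ⁺¹ ∖ 0 ≃ 𝕊ᵐ`; the inductive step is
  the isomorphism above for the complements of the images of the two closed hemispheres, which
  have no positive-degree homology by Prop. 2B.1(a), `isZero_compl_range_cube_holds`);
* `SphereComplement.nonempty_iso_compl_range_of_isEmbedding`,
  `SphereComplement.nonempty_compl_range_iso_coeff_of_isEmbedding` — **Prop. 2B.1(b), the degree
  `n - k - 1`**: for an embedding `h : 𝕊ᵏ → 𝕊ᵐ⁺¹` with `k + 1 ≤ m`,
  `H_{m-k}(𝕊ᵐ⁺¹ ∖ h(𝕊ᵏ); M) ≅ Hₘ(𝕊ᵐ; M) ≅ M`.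

Used (with `m + 1 = 4`) for knots `𝕊¹ ↪ 𝕊⁴` (`H₂` of the complement is `M`) and `2`-knots
`𝕊² ↪ 𝕊⁴` (`H₁` of the complement is `M`) in the homology computation of
`Literature/Topology/FourManifolds/ZeroSurgeryHomotopyBallSliceProofs.lean`.

Everything here is proved; no named facts, no new definitions.

## References

* A. Hatcher, *Algebraic Topology*, CUP 2002, §2.2 p. 149 (Mayer–Vietoris), Prop. 2B.1 and its
  proof, pp. 169–170 [HatcherAT2002].
-/

noncomputable section

open CategoryTheory Limits Set Function Metric unitInterval

universe u v

namespace Literature.AlgebraicTopology.SingularHomology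

variable (R : Type v) [CommRing R] (M : Type v) [AddCommGroup M] [Module R M]
variable {X : Type u} [TopologicalSpace X]

/-! ### The Mayer–Vietoris connecting map is an isomorphism when the outer terms vanish -/

namespace mayerVietoris

/-- **Mayer–Vietoris isomorphism criterion** (Hatcher 2002, §2.2, p. 149): if
`interior U ∪ interior V = X` and `Hₙ₊₁(U) = Hₙ₊₁(V) = Hₙ(U) = Hₙ(V) = 0`, then the connecting map
`δ : Hₙ₊₁(X; M) ⟶ Hₙ(U ∩ V; M)` is an isomorphism: it is injective by exactness at `Hₙ₊₁(X)`
(`exact₂_holds`, the incoming map has zero source) and surjective by exactness at `Hₙ(U ∩ V)`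
(`exact₃_holds`, the outgoing map has zero target). [cite: HatcherAT2002, §2.2 p. 149] -/
theorem isIso_δ_of_isZero (U V : Set X) (h : interior U ∪ interior V = Set.univ) (n : ℕ)
    (hU₁ : IsZero (singularHomology R M U (n + 1))) (hV₁ : IsZero (singularHomology R M V (n + 1)))
    (hU₀ : IsZero (singularHomology R M U n)) (hV₀ : IsZero (singularHomology R M V n)) :
    IsIso (δ R M U V
      (relativeSingularHomology.isIso_map_of_interior_union_interior_holds R M X) h n) := by
  have h₂ := exact₂_holds R M U V
    (relativeSingularHomology.isIso_map_of_interior_union_interior_holds R M X) h n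
  have h₃ := exact₃_holds R M U V
    (relativeSingularHomology.isIso_map_of_interior_union_interior_holds R M X) h n
  have hmono : Mono (δ R M U V
      (relativeSingularHomology.isIso_map_of_interior_union_interior_holds R M X) h n) :=
    h₂.mono_g (((biprod_isZero_iff _ _).2 ⟨hU₁, hV₁⟩).eq_of_src _ _)
  have hepi : Epi (δ R M U V
      (relativeSingularHomology.isIso_map_of_interior_union_interior_holds R M X) h n) :=
    h₃.epi_f (((biprod_isZero_iff _ _).2 ⟨hU₀, hV₀⟩).eq_of_tgt _ _)
  exact isIso_of_mono_of_epi _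

end mayerVietoris

namespace SphereComplement

variable {U₁ U₂ : Set X}

/-- **Mayer–Vietoris isomorphism criterion for two open subsets of an ambient space**: if
`U₁, U₂ ⊆ X` are open and `Hᵢ(U₁) = Hᵢ(U₂) = Hᵢ₊₁(U₁) = Hᵢ₊₁(U₂) = 0`, then
`Hᵢ₊₁(U₁ ∪ U₂; M) ≅ Hᵢ(U₁ ∩ U₂; M)` (the connecting map of the Mayer–Vietoris sequence of the
open cover `{U₁, U₂}` of `U₁ ∪ U₂`; Hatcher 2002, §2.2, p. 149, and p. 170 for its use in
Prop. 2B.1(b)). [cite: HatcherAT2002, §2.2 p. 149] -/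
theorem nonempty_iso_union_inter_of_isZero (hU₁ : IsOpen U₁) (hU₂ : IsOpen U₂) (i : ℕ)
    (h₁ : IsZero (singularHomology R M U₁ i)) (h₂ : IsZero (singularHomology R M U₂ i))
    (h₁' : IsZero (singularHomology R M U₁ (i + 1)))
    (h₂' : IsZero (singularHomology R M U₂ (i + 1))) :
    Nonempty (singularHomology R M ↥(U₁ ∪ U₂) (i + 1) ≅ singularHomology R M ↥(U₁ ∩ U₂) i) := by
  have hAB := interior_union_interior_eq_univ hU₁ hU₂
  -- the pieces of `U₁ ∪ U₂` are homeomorphic to `U₁`, `U₂`, `U₁ ∩ U₂`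
  let e₁ : ↥(Subtype.val ⁻¹' U₁ : Set ↥(U₁ ∪ U₂)) ≃ₜ ↥U₁ :=
    preimageValHomeomorphOfSubset subset_union_left
  let e₂ : ↥(Subtype.val ⁻¹' U₂ : Set ↥(U₁ ∪ U₂)) ≃ₜ ↥U₂ :=
    preimageValHomeomorphOfSubset subset_union_right
  let e : ↥((Subtype.val ⁻¹' U₁ : Set ↥(U₁ ∪ U₂)) ∩ Subtype.val ⁻¹' U₂) ≃ₜ ↥(U₁ ∩ U₂) :=
    preimageValHomeomorphOfSubset (S := U₁ ∪ U₂) (T := U₁ ∩ U₂)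
      (inter_subset_left.trans subset_union_left)
  have hA : IsZero (singularHomology R M ↥(Subtype.val ⁻¹' U₁ : Set ↥(U₁ ∪ U₂)) i) :=
    h₁.of_iso (singularHomology.mapIso R M e₁ i)
  have hB : IsZero (singularHomology R M ↥(Subtype.val ⁻¹' U₂ : Set ↥(U₁ ∪ U₂)) i) :=
    h₂.of_iso (singularHomology.mapIso R M e₂ i)
  have hA' : IsZero (singularHomology R M ↥(Subtype.val ⁻¹' U₁ : Set ↥(U₁ ∪ U₂)) (i + 1)) :=
    h₁'.of_iso (singularHomology.mapIso R M e₁ (i + 1))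
  have hB' : IsZero (singularHomology R M ↥(Subtype.val ⁻¹' U₂ : Set ↥(U₁ ∪ U₂)) (i + 1)) :=
    h₂'.of_iso (singularHomology.mapIso R M e₂ (i + 1))
  haveI := mayerVietoris.isIso_δ_of_isZero R M (Subtype.val ⁻¹' U₁ : Set ↥(U₁ ∪ U₂))
    (Subtype.val ⁻¹' U₂) hAB i hA' hB' hA hB
  exact ⟨asIso (mayerVietoris.δ R M (Subtype.val ⁻¹' U₁ : Set ↥(U₁ ∪ U₂)) (Subtype.val ⁻¹' U₂)
      (relativeSingularHomology.isIso_map_of_interior_union_interior_holds R M ↥(U₁ ∪ U₂)) hAB i) ≪≫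
    singularHomology.mapIso R M e i⟩

/-! ### Hatcher's Prop. 2B.1(b): the isomorphism part -/

section Spheres

variable {R M}

/-- A twice punctured `(m+1)`-sphere has the homology of `𝕊ᵐ`: `Hᵢ(𝕊ᵐ⁺¹ ∖ {v, w}; M) ≅ Hᵢ(𝕊ᵐ; M)`
(`𝕊ᵐ⁺¹ ∖ {v, w} ≃ₜ ℝᵐ⁺¹ ∖ {0} ≃ 𝕊ᵐ`: `sphereMinusTwoPointsHomeomorph`,
`sphereHomotopyEquivPunctured`;
Hatcher 2002, Prop. 2B.1(b), the case `k = 0`). [cite: HatcherAT2002, Prop. 2B.1(b), case k = 0] -/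
theorem nonempty_iso_compl_pair_sphere {m : ℕ}
    (v w : Metric.sphere (0 : EuclideanSpace ℝ (Fin (m + 1 + 1))) 1) (hw : w ≠ v) (i : ℕ) :
    Nonempty (singularHomology R M
        ↥(({v, w} : Set (Metric.sphere (0 : EuclideanSpace ℝ (Fin (m + 1 + 1))) 1))ᶜ) i ≅
      singularHomology R M (Metric.sphere (0 : EuclideanSpace ℝ (Fin (m + 1))) 1) i) :=
  ⟨singularHomology.mapIso R M (sphereMinusTwoPointsHomeomorph v w hw) i ≪≫
    (singularHomology.isoOfHomotopyEquiv R M (sphereHomotopyEquivPunctured (m + 1)) i).symm⟩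

/-- **Hatcher's Prop. 2B.1(b), isomorphism part, for continuous injections**: for `k ≤ m`, a
continuous injection `f : 𝕊ᵏ → 𝕊ᵐ⁺¹` and `i ≥ 1`, `Hᵢ(𝕊ᵐ⁺¹ ∖ f(𝕊ᵏ); M) ≅ Hᵢ₊ₖ(𝕊ᵐ; M)` (stated
with `j = i + k` free, to avoid index transport). Induction on `k` exactly as in the vanishing part
`isZero_compl_range_sphere`: for `k = 0` the complement of two points of `𝕊ᵐ⁺¹` is
`ℝᵐ⁺¹ ∖ {0} ≃ 𝕊ᵐ`; for the inductive step `𝕊ᵏ⁺¹ = D₊ ∪ D₋` (closed hemispheres, cubes) with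
`D₊ ∩ D₋ = 𝕊ᵏ` (equator), so `𝕊ᵐ⁺¹ ∖ f(𝕊ᵏ) = (𝕊ᵐ⁺¹ ∖ f(D₊)) ∪ (𝕊ᵐ⁺¹ ∖ f(D₋))` with intersection
`𝕊ᵐ⁺¹ ∖ f(𝕊ᵏ⁺¹)`; both pieces have no positive-degree homology by Prop. 2B.1(a)
(`isZero_compl_range_cube_holds`), and the Mayer–Vietoris connecting map is an isomorphism
`Hᵢ₊₁(𝕊ᵐ⁺¹ ∖ f(𝕊ᵏ)) ≅ Hᵢ(𝕊ᵐ⁺¹ ∖ f(𝕊ᵏ⁺¹))` (`nonempty_iso_union_inter_of_isZero`); Hatcher 2002,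
p. 170: "the Mayer–Vietoris sequence gives isomorphisms `H̃ᵢ(Sⁿ − h(Sᵏ)) ≈ H̃ᵢ₊₁(Sⁿ − h(Sᵏ⁻¹))`".
[cite: HatcherAT2002, Prop. 2B.1(b)] -/
theorem nonempty_iso_compl_range_sphere (k : ℕ) :
    ∀ {m : ℕ} (f : C(Metric.sphere (0 : EuclideanSpace ℝ (Fin (k + 1))) 1,
        Metric.sphere (0 : EuclideanSpace ℝ (Fin (m + 1 + 1))) 1)), Injective f → k ≤ m →
      ∀ {i j : ℕ}, 1 ≤ i → j = i + k →
        Nonempty (singularHomology R M ↥(range f)ᶜ i ≅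
          singularHomology R M (Metric.sphere (0 : EuclideanSpace ℝ (Fin (m + 1))) 1) j) := by
  induction k with
  | zero =>
    intro m f hf _ i j _ hj
    obtain rfl : i = j := by omega
    rw [range_eq_pair_of_sphere_zero]
    exact nonempty_iso_compl_pair_sphere _ _ (fun h => pole_one_ne_pole_neg_one (hf h).symm) i
  | succ k ih =>
    intro m f hf hkm i j hi hj
    -- the two closed hemispheres and the complements of their images
    let g : ∀ (ε : ℝ) (_ : ε ^ 2 = 1),
        C((Fin (k + 1) → I), Metric.sphere (0 : EuclideanSpace ℝ (Fin (m + 1 + 1))) 1) :=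
      fun ε hε => f.comp ⟨hemisphere ε hε, continuous_hemisphere ε hε⟩
    have hg : ∀ (ε : ℝ) (hε : ε ^ 2 = 1), Injective (g ε hε) := fun ε hε =>
      hf.comp (hemisphere_injective ε hε)
    have hgo : ∀ (ε : ℝ) (hε : ε ^ 2 = 1), IsOpen (range (g ε hε))ᶜ := fun ε hε =>
      (isCompact_range (g ε hε).continuous).isClosed.isOpen_compl
    have hgr : ∀ (ε : ℝ) (hε : ε ^ 2 = 1), range (g ε hε) = f '' range (hemisphere ε hε) :=
      fun ε hε => range_comp f (hemisphere ε hε)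
    have h1 : (1 : ℝ) ^ 2 = 1 := by norm_num
    have h1' : (-1 : ℝ) ^ 2 = 1 := by norm_num
    have hW : (range (g 1 h1))ᶜ ∩ (range (g (-1) h1'))ᶜ = (range f)ᶜ := by
      rw [← compl_union, hgr, hgr, ← image_union, range_hemisphere_union_range_hemisphere,
        image_univ]
    let e : C(Metric.sphere (0 : EuclideanSpace ℝ (Fin (k + 1))) 1,
        Metric.sphere (0 : EuclideanSpace ℝ (Fin (m + 1 + 1))) 1) :=
      f.comp ⟨equator, continuous_equator⟩
    have hY : (range (g 1 h1))ᶜ ∪ (range (g (-1) h1'))ᶜ = (range e)ᶜ := by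
      rw [← compl_inter, hgr, hgr, ← image_inter hf, range_hemisphere_inter_range_hemisphere,
        ← range_equator, ← range_comp]
      rfl
    -- the complements of the images of the hemispheres have no positive-degree homology
    have hvan : ∀ (ε : ℝ) (hε : ε ^ 2 = 1) (l : ℕ), l ≠ 0 →
        IsZero (singularHomology R M ↥(range (g ε hε))ᶜ l) := fun ε hε l hl =>
      isZero_compl_range_cube_holds R M (fun x l hl => isZero_compl_singleton_sphere x hl)
        (k + 1) (g ε hε) (hg ε hε) l hl
    -- Mayer–Vietoris: `Hᵢ₊₁(𝕊 ∖ f(𝕊ᵏ)) ≅ Hᵢ(𝕊 ∖ f(𝕊ᵏ⁺¹))`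
    obtain ⟨eMV⟩ := nonempty_iso_union_inter_of_isZero R M (hgo 1 h1) (hgo (-1) h1') i
      (hvan 1 h1 i (by omega)) (hvan (-1) h1' i (by omega))
      (hvan 1 h1 (i + 1) (by omega)) (hvan (-1) h1' (i + 1) (by omega))
    -- induction hypothesis for the equator `e : 𝕊ᵏ → 𝕊ᵐ⁺¹` in degree `i + 1`
    obtain ⟨eIH⟩ := ih e (hf.comp equator_injective) (by omega) (i := i + 1) (j := j)
      (by omega) (by omega)
    exact ⟨(singularHomology.mapIso R M (Homeomorph.setCongr hW) i).symm ≪≫ eMV.symm ≪≫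
      singularHomology.mapIso R M (Homeomorph.setCongr hY) (i + 1) ≪≫ eIH⟩

/-- **Hatcher's Prop. 2B.1(b), isomorphism part**: for an embedding `h : 𝕊ᵏ → 𝕊ᵐ⁺¹`, `k ≤ m`,
and `i ≥ 1`, `Hᵢ(𝕊ᵐ⁺¹ ∖ h(𝕊ᵏ); M) ≅ Hᵢ₊ₖ(𝕊ᵐ; M)`. (With `isZero_singularHomology_sphere_holds`
this recovers the vanishing part `isZero_compl_range_of_isEmbedding_holds` in positive degrees,
and in degree `i = m - k` it is the non-vanishing statement below.)
[cite: HatcherAT2002, Prop. 2B.1(b)] -/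
theorem nonempty_iso_compl_range_of_isEmbedding {k m i : ℕ}
    (h : Metric.sphere (0 : EuclideanSpace ℝ (Fin (k + 1))) 1 →
      Metric.sphere (0 : EuclideanSpace ℝ (Fin (m + 1 + 1))) 1)
    (he : Topology.IsEmbedding h) (hkm : k ≤ m) (hi : 1 ≤ i) :
    Nonempty (singularHomology R M
        ↥((range h)ᶜ : Set (Metric.sphere (0 : EuclideanSpace ℝ (Fin (m + 1 + 1))) 1)) i ≅
      singularHomology R M (Metric.sphere (0 : EuclideanSpace ℝ (Fin (m + 1))) 1) (i + k)) :=
  nonempty_iso_compl_range_sphere k ⟨h, he.continuous⟩ he.injective hkm hi rfl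

variable (R M) in
/-- **Hatcher's Prop. 2B.1(b), the degree `n - k - 1`: `H_{m-k}(𝕊ᵐ⁺¹ ∖ h(𝕊ᵏ); M) ≅ M`** for an
embedding `h : 𝕊ᵏ → 𝕊ᵐ⁺¹` with `k + 1 ≤ m` (so that the degree `m - k = (m + 1) - k - 1` is
positive): by `nonempty_iso_compl_range_of_isEmbedding` it is `Hₘ(𝕊ᵐ; M) ≅ M` (Hatcher Cor. 2.14,
`nonempty_singularHomology_sphere_iso_holds`). For `m + 1 = 4`: the complement of a knot
`𝕊¹ ↪ 𝕊⁴` has `H₂ ≅ M`, the complement of a `2`-knot `𝕊² ↪ 𝕊⁴` has `H₁ ≅ M`.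
[cite: HatcherAT2002, Prop. 2B.1(b)] -/
theorem nonempty_compl_range_iso_coeff_of_isEmbedding {k m : ℕ}
    (h : Metric.sphere (0 : EuclideanSpace ℝ (Fin (k + 1))) 1 →
      Metric.sphere (0 : EuclideanSpace ℝ (Fin (m + 1 + 1))) 1)
    (he : Topology.IsEmbedding h) (hkm : k + 1 ≤ m) :
    Nonempty (singularHomology R M
        ↥((range h)ᶜ : Set (Metric.sphere (0 : EuclideanSpace ℝ (Fin (m + 1 + 1))) 1)) (m - k) ≅
      ModuleCat.of R (ULift M)) := by
  obtain ⟨e₁⟩ := nonempty_iso_compl_range_of_isEmbedding (R := R) (M := M) (i := m - k) h he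
    (by omega) (by omega)
  obtain ⟨e₂⟩ := nonempty_singularHomology_sphere_iso_holds R M (n := m) (by omega)
  rw [Nat.sub_add_cancel (by omega)] at e₁
  exact ⟨e₁ ≪≫ e₂⟩

end Spheres

end SphereComplement

end Literature.AlgebraicTopology.SingularHomology
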